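import Summits.CriticalPhenomena.PercolationContinuityZ3.Theorems.FK.MagnetizationFieldDerivative
import Summits.CriticalPhenomena.PercolationContinuityZ3.Theorems.FK.IsingMagnetizationVariance
import HarnessLib

/-!
# THE FLUCTUATION–RESPONSE THEOREM IN VARIANCE FORM: `∂⁺m/∂h (β,h) = β lim_n |Λ_n|⁻¹ Var⁺_{β,h}(M_{Λ_n})`
# (Ellis 2006, eq. (5.25): «β·σ²(β,h) = β·lim |Λ|⁻¹{⟨S_Λ²⟩ − ⟨S_Λ⟩²} = χ(β,h)»)

Claimed R42 (8)(c) in the cell INBOX at 2026-08-28T21:27:52Z by fkp-10a gen 356 (NEW CLAIM #1 of the gen), addressed to coordinator fk-4 (next seated gen; (ι) in force for windows); lineage row FO-10a-g356 (self-suggested), package g356-susceptibility, label FR-G.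
Helper file of the `fk-continuity` build cell (bschramm lane; `--supports stmt-CriticalPhenomena-4575`); builds on
p205010 (kernel theorem, internal audit signed; external expert review pending). No definitions, no named facts, no
sorries; standard axioms. UNCONDITIONAL (nearest-neighbour Ising model on `ℤ^d`).

Reformulations of the fluctuation–response theorem of `MagnetizationFieldDerivative` over the SAME objects, combining it
with the row FO-10a-g355v variance asymptotics (`IsingCLT.tendsto_variance_boxSpinSum_div_card`, Ellis Lemma V.7.1):
for `β > 0`, `h > 0` and the plus state `μ` (`spinCorr μ A = plusCorr d β h A`),

* `hasDerivWithinAt_magnetizationInField_Ici_covariance` — `∂⁺m/∂h (β,h) = β Σ'_z Cov_μ(σ_0,σ_z)` (the susceptibility sum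
  IS the sum of the spin covariances of the infinite-volume state);
* **`tendsto_variance_boxSpinSum_div_card_derivWithin`** — **Ellis (5.25)**: `β Var_μ(M_n)/|Λ_n| → ∂⁺m/∂h (β,h)`
  (`derivWithin (m(β,·)) (Ici h) h`): the response of the magnetisation to the field is `β` times the limiting
  per-site variance of the total magnetisation;
* `derivWithin_magnetizationInField_Ici` — `derivWithin (m(β,·)) (Ici h) h = β σ²(β,h)` for every `h > 0`;
  `antitoneOn_derivWithin_magnetizationInField` — the right derivative `h ↦ ∂⁺m/∂h (β,h)` is nonincreasing on `(0,∞)`;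
  `derivWithin_magnetizationInField_Ici_le` — `0 ≤ ∂⁺m/∂h (β,h) ≤ 4/h` (the GHS bound `χ⁺(β,h) ≤ 4/(βh)` of
  `IsingPositiveFieldCLT`);
* `continuousOn_magnetizationInField_Ioi` — `m(β,·)` is continuous on `(0,∞)` (`β ≥ 0`; concavity);
* `exists_plusState_hasDerivWithinAt_magnetizationInField` — the covariance form with the plus state supplied
  (`exists_plusMeasure_holds`).

## References

* R. S. Ellis, *Entropy, Large Deviations, and Statistical Mechanics*, Springer (1985/2006), eq. (5.25), Lemma V.7.1,
  Lemma V.7.4. [Ellis2006]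
* S. Friedli, Y. Velenik, *Statistical Mechanics of Lattice Systems*, CUP (2017), §3.7.4, Exercise 3.34. [FriedliVelenik2017]
-/

noncomputable section

namespace Summit.CriticalPhenomena.PercolationContinuityZ3.Theorems.FK

namespace IsingSusceptibility

open MeasureTheory ProbabilityTheory Filter Topology Finset Set
open scoped symmDiff
open Literature.Probability.LatticeModels
open Summit.CriticalPhenomena.PercolationContinuityZ3.Theorems.FK.IsingCLT

variable {d : ℕ}

/-- In the plus state the spin covariances are the truncated plus two-point function:
`Cov_μ(σ_0,σ_z) = ⟨σ_{{0}∆{z}}⟩⁺_{β,h} − ⟨σ_0⟩⁺_{β,h}⟨σ_z⟩⁺_{β,h}`. [cite: FriedliVelenik2017, Thm. 3.17] -/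
theorem covariance_spinAt_zero_eq_plusTruncated {β h : ℝ} (hβ : 0 ≤ β) {μ : Measure (SpinConfig (Site d))}
    [IsProbabilityMeasure μ] (hμ : ∀ A : Finset (Site d), spinCorr μ A = plusCorr d β h A) (z : Site d) :
    cov[spinAt 0, spinAt z; μ] = plusCorr d β h ({0} ∆ {z}) - plusCorr d β h {0} * plusCorr d β h {z} := by
  rw [covariance_spinAt_eq_plusTruncated hβ hμ 0 z, sub_zero]

/-- **`∂⁺m/∂h (β,h) = β Σ_z Cov⁺_{β,h}(σ_0,σ_z)`** for `β > 0`, `h > 0` and the plus state `μ` at `(β,h)`.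
[cite: Ellis2006, Lemma V.7.4, eq. (5.28)] -/
theorem hasDerivWithinAt_magnetizationInField_Ici_covariance {β h : ℝ} (hβ : 0 < β) (hh : 0 < h)
    {μ : Measure (SpinConfig (Site d))} [IsProbabilityMeasure μ]
    (hμ : ∀ A : Finset (Site d), spinCorr μ A = plusCorr d β h A) :
    HasDerivWithinAt (fun t => magnetizationInField d β t) (β * ∑' z : Site d, cov[spinAt 0, spinAt z; μ]) (Ici h) h := by
  simp only [covariance_spinAt_zero_eq_plusTruncated hβ.le hμ]
  exact hasDerivWithinAt_magnetizationInField_Ici_of_pos hβ hh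

/-- **`derivWithin (m(β,·)) [h,∞) h = β σ²(β,h)`** for `β > 0`, `h > 0`. [cite: Ellis2006, Lemma V.7.4, eq. (5.28)] -/
theorem derivWithin_magnetizationInField_Ici {β h : ℝ} (hβ : 0 < β) (hh : 0 < h) :
    derivWithin (fun t => magnetizationInField d β t) (Ici h) h =
      β * ∑' z : Site d, (plusCorr d β h ({0} ∆ {z}) - plusCorr d β h {0} * plusCorr d β h {z}) :=
  (hasDerivWithinAt_magnetizationInField_Ici_of_pos hβ hh).derivWithin ((uniqueDiffOn_Ici h) h self_mem_Ici)

/-- **ELLIS (5.25) — THE FLUCTUATION–RESPONSE THEOREM IN VARIANCE FORM**: for `β > 0`, `h > 0` and the plus state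
`μ` at `(β,h)`, with `M_n = Σ_{x∈Λ_n} σ_x`,
`β · Var_μ(M_n)/|Λ_n| → ∂⁺m/∂h (β,h) = derivWithin (m(β,·)) [h,∞) h` as `n → ∞`
(Ellis Lemma V.7.1 for the variance, `IsingCLT.tendsto_variance_boxSpinSum_div_card`, and the fluctuation–response
theorem for the right derivative). [cite: Ellis2006, eq. (5.25), Lemma V.7.1 and Lemma V.7.4] -/
theorem tendsto_variance_boxSpinSum_div_card_derivWithin {β h : ℝ} (hβ : 0 < β) (hh : 0 < h)
    {μ : Measure (SpinConfig (Site d))} [IsProbabilityMeasure μ]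
    (hμ : ∀ A : Finset (Site d), spinCorr μ A = plusCorr d β h A) :
    Tendsto (fun n : ℕ => β * (Var[fun σ => ∑ z ∈ box d n, spinAt z σ; μ] / #(box d n))) atTop
      (𝓝 (derivWithin (fun t => magnetizationInField d β t) (Ici h) h)) := by
  have hsum : Summable fun z : Site d => cov[spinAt 0, spinAt z; μ] := by
    simp only [covariance_spinAt_zero_eq_plusTruncated hβ.le hμ]
    exact summable_plusTruncated_of_pos_field hβ hh
  rw [derivWithin_magnetizationInField_Ici hβ hh]
  simp only [← covariance_spinAt_zero_eq_plusTruncated hβ.le hμ]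
  exact (tendsto_variance_boxSpinSum_div_card (isTranslationInvariantMeasure_of_spinCorr_eq_plusCorr hβ.le hμ)
    hsum).const_mul β

/-- **The right derivative `h ↦ ∂⁺m/∂h (β,h)` is nonincreasing on `(0, ∞)`** (`β > 0`): it equals `β σ²(β,h)`, and
`σ²(β,·)` is nonincreasing by GHS (`antitoneOn_tsum_plusTruncated`). [cite: Ellis2006, Lemma V.7.3 (b) and Lemma V.7.4] -/
theorem antitoneOn_derivWithin_magnetizationInField {β : ℝ} (hβ : 0 < β) :
    AntitoneOn (fun h => derivWithin (fun t => magnetizationInField d β t) (Ici h) h) (Ioi 0) := by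
  intro a ha b hb hab
  simp only [derivWithin_magnetizationInField_Ici hβ ha, derivWithin_magnetizationInField_Ici hβ hb]
  exact mul_le_mul_of_nonneg_left (antitoneOn_tsum_plusTruncated (d := d) hβ ha hb hab) hβ.le

/-- **`0 ≤ ∂⁺m/∂h (β,h) ≤ 4/h`** for `β > 0`, `h > 0` (FKG positivity and the GHS susceptibility bound
`Σ_z ⟨σ_0;σ_z⟩⁺_{β,h} ≤ 4/(βh)`, `tsum_plusTruncated_le_of_pos_field`). [cite: Ellis2006, Thm. V.7.2 (b), Lemma V.7.4] -/
theorem derivWithin_magnetizationInField_Ici_le {β h : ℝ} (hβ : 0 < β) (hh : 0 < h) :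
    0 ≤ derivWithin (fun t => magnetizationInField d β t) (Ici h) h ∧
      derivWithin (fun t => magnetizationInField d β t) (Ici h) h ≤ 4 / h := by
  rw [derivWithin_magnetizationInField_Ici hβ hh]
  refine ⟨mul_nonneg hβ.le (tsum_nonneg fun z => plusTruncated_nonneg hβ.le h 0 z), ?_⟩
  calc β * ∑' z : Site d, (plusCorr d β h ({0} ∆ {z}) - plusCorr d β h {0} * plusCorr d β h {z})
      ≤ β * (4 / (β * h)) := mul_le_mul_of_nonneg_left (tsum_plusTruncated_le_of_pos_field hβ hh) hβ.le
    _ = 4 / h := by field_simp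

/-- **`m(β,·)` is continuous on `(0, ∞)`** (`β ≥ 0`; a concave function is continuous on the interior of its domain).
[cite: FriedliVelenik2017, Remark 3.41; Rockafellar1970, Thm. 10.1] -/
theorem continuousOn_magnetizationInField_Ioi {β : ℝ} (hβ : 0 ≤ β) :
    ContinuousOn (fun t => magnetizationInField d β t) (Ioi 0) := by
  have := (concaveOn_magnetizationInField (d := d) hβ).continuousOn_interior
  rwa [interior_Ici] at this

/-- **Non-vacuity: the variance form with the plus state supplied** — for every `d`, `β > 0`, `h > 0` there is a
translation-invariant Gibbs measure `μ ∈ 𝒢(β,h)` with `spinCorr μ = plusCorr d β h` (`exists_plusMeasure_holds`), and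
for it `β Var_μ(M_n)/|Λ_n| → ∂⁺m/∂h (β,h) = β Σ_z Cov_μ(σ_0,σ_z)`. [cite: Ellis2006, eq. (5.25); FriedliVelenik2017, Thm. 3.17] -/
theorem exists_plusState_tendsto_variance_derivWithin {β h : ℝ} (hβ : 0 < β) (hh : 0 < h) :
    ∃ (μ : Measure (SpinConfig (Site d))) (_ : IsProbabilityMeasure μ), μ ∈ isingGibbsMeasures d β h ∧
      IsTranslationInvariantMeasure μ ∧ (∀ A : Finset (Site d), spinCorr μ A = plusCorr d β h A) ∧
      HasDerivWithinAt (fun t => magnetizationInField d β t) (β * ∑' z : Site d, cov[spinAt 0, spinAt z; μ]) (Ici h) h ∧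
      Tendsto (fun n : ℕ => β * (Var[fun σ => ∑ z ∈ box d n, spinAt z σ; μ] / #(box d n))) atTop
        (𝓝 (derivWithin (fun t => magnetizationInField d β t) (Ici h) h)) := by
  obtain ⟨μ, hμG, hμT, hμc⟩ := exists_plusMeasure_holds (d := d) (β := β) (h := h) hβ.le
  haveI : IsProbabilityMeasure μ := ((mem_isingGibbsMeasures_iff d β h μ).1 hμG).isProbabilityMeasure
  exact ⟨μ, inferInstance, hμG, hμT, hμc, hasDerivWithinAt_magnetizationInField_Ici_covariance hβ hh hμc,
    tendsto_variance_boxSpinSum_div_card_derivWithin hβ hh hμc⟩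

end IsingSusceptibility

end Summit.CriticalPhenomena.PercolationContinuityZ3.Theorems.FK

end
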